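/-
# `Balaban1983to89.B5Eq128OfRecord` — Bałaban CMP 95 (1984), (1.128) FOR THE OPERATOR OF RECORD, HYPOTHESIS-FREE, in its PRINTED sup
# currency (and on the adjoint carrier): the (1.126) input discharged by the tree's theorem

statement-level skeleton of published theorems with citation tags; proofs where landed; nothing here is a claim
about the Yang–Mills mass gap

CITATION HEADER (lean-in-tree rule).  Cell `lit-balaban`, unit `lit-balaban-r02` (reader/typer r02 gen 11 = fold owner of block B5),
HOME `run/shared/lean/pub/lit-balaban/` (SKELETON row B5.Eq1.128 — the row's theorem of record for the printed display; B5.Prop1.2 cell).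
B5 = T. Bałaban, *Propagators and renormalization transformations for lattice gauge theories. I*, Commun. Math. Phys. **95** (1984) 17–40
[`Balaban1984PropagatorsI`], held as `paper:balaban1984-cmp95-propagators-rt-i` (p. 38 = text layer p0022).  Inputs: own `B5SupRepTorus.h128P_holds`
(p317540, sup carrier of record) and `B5OneH128Torus.h128one_holds` (p318614, adjoint carrier), which take the (1.126)-type entry bound as a
hypothesis, and p16's THEOREM (1.126) for the kernel `∂·PcT·∂ᴴ` of record, `B5PBridgeKernel126.holder_GradOp_PcT_GradOp_adjoint`.

WHAT IS PRINTED.  p. 38 [PDF 22] L8–12, verbatim: «Let us write bounds for the operator ∂P∂*. They follow from the representation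
P = G′Q′*(Q′G′²Q′*)⁻¹Q′G′, from Lemma 2.4 of [2], and the representation (1.45) and the analyticity method of proving an exponential decay
(see the proof of Lemma 2.4 in [2]). We obtain |(∂P∂*)_{μ,ν}(x, x′)| ≤ O(1)e^{−δ′₀|x−x′|}, (1.126)»; p. 38 L15: «The constant O(1) in (1.126)
depends on d only»; p. 38 L23–24: «Defining 2δ₀ = min{⅓δ′₀, M₀⁻¹}, we obtain |h_{z₁}K(h_{z₂})A| ≤ O(M₀⁻¹)e^{−2δ₀|z₁−z₂|}(|∇A| + |A|). (1.128)».
(v1.1, r05 SECOND-READ-B5 pass 22 note 22-(d): the v1 lead-in «It follows from Proposition 1.2 for G₀(Ω), more exactly from (1.114), that»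
was NOT printed text — it was our paraphrase of how the TREE obtains (1.126) (p16's theorem via Prop. 1.2 for G₀); replaced by the printed
sentence; declarations byte-identical to v1 p319238.)

WHAT THIS MODULE PROVES (kernel-checked, zero sorry).  For every dimension `d + 1 ≥ 1` and every `a`:
* `entry126_of_record` — the (1.126) entry bound for the matrix `VC n M = ∂·PcT·∂ᴴ` of record, uniformly in the lattice `n` and the torus
  `M`: `∃ δ > 0, C > 0, ∀ n M i j, ‖VC n M i j‖ ≤ C·η^{d+1}·e^{−δ|x_i − x_j|}` (p16's theorem, re-indexed by bonds);
* **`h128_sup_of_record`** — (1.128) AS PRINTED, HYPOTHESIS-FREE, for `Δ_a` of record on the sup carrier of record: `∃ δ′₀ > 0, θ ≥ 0` (functions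
  of `d, a` only) such that for every lattice `n ≥ 1`, torus `M`, cube scale `M₀ ≥ 1`, centres `z₁ z₂` and vector field `v`,
  `‖h_{z₁}K(h_{z₂})v‖_∞ ≤ (θ/M₀)·e^{−twoDelta0 δ′₀ M₀·|z₁−z₂|}·(‖∇v‖_∞ + ‖v‖_∞)` with `twoDelta0 δ′₀ M₀ = min{⅓δ′₀, M₀⁻¹}` — the printed
  «O(M₀⁻¹)» is `θ/M₀`, `θ = thetaW (d+1) a δ′₀ C`;
* **`h128_one_of_record`** — the same on the adjoint carrier `V1` («representation of G adjoint to (1.123)», p. 39), same `δ′₀, θ`.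

HONEST SCOPE.  (1) Constants existential-uniform (depend on `d, a` through p16's (1.126) constants and `thetaW`), not numerical; rate exact.
(2) `d + 1 ≥ 1` because the tree's (1.126) theorem is stated for `Fin (d + 1)`.  (3) Value = the row's display (1.128) as a closed theorem for the
objects of record in the printed currency (cell book-keeping: B5.Eq1.128 head), NOT summit progress.
-/
import Mathlib
import Literature.MathematicalPhysics.QuantumFieldTheory.Balaban1983to89.B5OneH128Torus

namespace Literature.MathematicalPhysics.QuantumFieldTheory.Balaban1983to89.B5Eq128OfRecord

open Literature.MathematicalPhysics.QuantumFieldTheory.Balaban1983to89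
open Literature.MathematicalPhysics.QuantumFieldTheory.Balaban1983to89.B5Prop12FieldsLattice (distU)
open Literature.MathematicalPhysics.QuantumFieldTheory.Balaban1983to89.B5Walk131 (twoDelta0)
open Literature.MathematicalPhysics.QuantumFieldTheory.Balaban1983to89.B5Local114 (Kop)
open Literature.MathematicalPhysics.QuantumFieldTheory.Balaban1983to89.B5SettingP12Real (VecR)
open Literature.MathematicalPhysics.QuantumFieldTheory.Balaban1983to89.B5WalkTorusGeom (Cen ctr)
open Literature.MathematicalPhysics.QuantumFieldTheory.Balaban1983to89.B5WalkCarrierTorus (Bnd)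
open Literature.MathematicalPhysics.QuantumFieldTheory.Balaban1983to89.B5WalkH128Torus (VC thetaW thetaW_nonneg)
open Literature.MathematicalPhysics.QuantumFieldTheory.Balaban1983to89.B5PBridgeKernel126 (holder_GradOp_PcT_GradOp_adjoint)
open Literature.MathematicalPhysics.QuantumFieldTheory.Balaban1983to89.B5SupCarrierTorus (Hs DAs Dgs V1 H1 DA1 Dg1)
open Literature.MathematicalPhysics.QuantumFieldTheory.Balaban1983to89.B5SupRepTorus (h128P_holds)
open Literature.MathematicalPhysics.QuantumFieldTheory.Balaban1983to89.B5OneH128Torus (h128one_holds)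

noncomputable section

/-! ## (1.126) for the kernel of record, and (1.128) hypothesis-free on both carriers -/

/-- **(1.126) FOR THE KERNEL OF RECORD, BOND-INDEXED**: `∃ δ > 0, C > 0` (functions of `d` only) with `‖(∂·PcT·∂ᴴ)_{ij}‖ ≤ C·η^{d+1}·e^{−δ|x_i−x_j|}`
for every lattice `n`, torus `M` and bonds `i, j` — p16's `holder_GradOp_PcT_GradOp_adjoint` read at `(i.1, i.2), (j.1, j.2)`.
[cite: Balaban1984PropagatorsI, (1.126) p.38] -/
theorem entry126_of_record (d : ℕ) : ∃ δ C : ℝ, 0 < δ ∧ 0 < C ∧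
    ∀ (n : ℕ) [NeZero n] (M : Fin (d + 1) → ℕ) [∀ μ, NeZero (M μ)] (i j : Bnd n M),
      ‖VC n M i j‖ ≤ C * ((n : ℝ) ^ (d + 1))⁻¹ * Real.exp (-(δ * distU n M i.1 j.1)) := by
  obtain ⟨δ, C, Cα, hδ, hC, h⟩ := holder_GradOp_PcT_GradOp_adjoint d
  exact ⟨δ, C, hδ, hC, fun n _ M _ i j => (h n M i.2 j.2).1 i.1 j.1⟩

/-- **(1.128) AS PRINTED, HYPOTHESIS-FREE, FOR `Δ_a` OF RECORD ON THE SUP CARRIER OF RECORD**: there are `δ′₀ > 0` and `θ ≥ 0`, depending on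
`d, a` only, such that for every lattice `n ≥ 1`, torus `M`, cube scale `M₀ ≥ 1`, centres `z₁, z₂` and real vector field `v`,
`‖h_{z₁}K(h_{z₂})v‖_∞ ≤ (θ/M₀)·e^{−min{⅓δ′₀, M₀⁻¹}·|z₁−z₂|}·(‖∇v‖_∞ + ‖v‖_∞)` («|h_{z₁}K(h_{z₂})A| ≤ O(M₀⁻¹)e^{−2δ₀|z₁−z₂|}(|∇A| + |A|). (1.128)»;
own `h128P_holds` with the (1.126) input discharged by `entry126_of_record`). [cite: Balaban1984PropagatorsI, (1.128) p.38, (1.126) p.38] -/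
theorem h128_sup_of_record (d : ℕ) (a : ℝ) : ∃ δ θ : ℝ, 0 < δ ∧ 0 ≤ θ ∧
    ∀ (n : ℕ) [NeZero n] (M : Fin (d + 1) → ℕ) [∀ μ, NeZero (M μ)], 1 ≤ n → ∀ (M₀ : ℕ), 1 ≤ M₀ →
      ∀ (z₁ z₂ : Cen M M₀) (v : VecR n M),
        ‖Hs n M M₀ z₁ (Kop (DAs n M a) (Hs n M M₀) z₂ v)‖
          ≤ θ / M₀ * Real.exp (-(twoDelta0 δ M₀ * dist (ctr M M₀ z₁) (ctr M M₀ z₂))) * (‖Dgs n M v‖ + ‖v‖) := by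
  obtain ⟨δ, C, hδ, hC, h⟩ := entry126_of_record d
  exact ⟨δ, thetaW (d + 1) a δ C, hδ, thetaW_nonneg (d + 1) a hδ hC.le,
    fun n _ M _ hn M₀ hM₀ z₁ z₂ v => h128P_holds hn hM₀ hδ hC.le (h n M) z₁ z₂ v⟩

/-- **(1.128) ON THE ADJOINT CARRIER OF RECORD, HYPOTHESIS-FREE** («a representation of G adjoint to (1.123), with the operators K(h) acting on
the right», p. 39): the same `δ′₀, θ` serve the `ℓ¹` carrier `V1` (own `h128one_holds` + `entry126_of_record`).
[cite: Balaban1984PropagatorsI, (1.128) p.38, p.39 L7–9, (1.126) p.38] -/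
theorem h128_one_of_record (d : ℕ) (a : ℝ) : ∃ δ θ : ℝ, 0 < δ ∧ 0 ≤ θ ∧
    ∀ (n : ℕ) [NeZero n] (M : Fin (d + 1) → ℕ) [∀ μ, NeZero (M μ)], 1 ≤ n → ∀ (M₀ : ℕ), 1 ≤ M₀ →
      ∀ (z₁ z₂ : Cen M M₀) (A : V1 n M),
        ‖H1 n M M₀ z₁ (Kop (DA1 n M a) (H1 n M M₀) z₂ A)‖
          ≤ θ / M₀ * Real.exp (-(twoDelta0 δ M₀ * dist (ctr M M₀ z₁) (ctr M M₀ z₂))) * (‖Dg1 n M A‖ + ‖A‖) := by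
  obtain ⟨δ, C, hδ, hC, h⟩ := entry126_of_record d
  exact ⟨δ, thetaW (d + 1) a δ C, hδ, thetaW_nonneg (d + 1) a hδ hC.le,
    fun n _ M _ hn M₀ hM₀ z₁ z₂ A => h128one_holds hn hM₀ hδ hC.le (h n M) z₁ z₂ A⟩

end

end Literature.MathematicalPhysics.QuantumFieldTheory.Balaban1983to89.B5Eq128OfRecord
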